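import Literature.NumberTheory.EllipticCurves.Szpiro
import Literature.NumberTheory.EllipticCurves.ModularCurve
import Literature.NumberTheory.Automorphic.BrandtXi
import Literature.NumberTheory.EllipticCurves.NewformsTwistPacketProofs
import Literature.NumberTheory.Automorphic.ShimuraCurveRibetTakahashiOptimalModularityProofs
import HarnessLib

/-!
# stub-ideation k1 gen 41 — Plan J ("JL bootstrap / hypothesis harvest") helper signatures

Sanity-elaboration ONLY (sorried bodies; no proving in this seat).  `HJ1` is provable NOW from the
tree + the XiMono certificate (theta lift, Eichler commutation, degree zero, Atkin–Lehner–Li packet);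
`HJ2` is the fact-dependent completion (Eichler–Shimura construction + Carayol + uniformisation datum)
and is recorded as a `Prop`, not claimed.
-/

open scoped MatrixGroups ModularForm
open CongruenceSubgroup
open Literature.NumberTheory.Automorphic
open Literature.NumberTheory.EllipticCurves
open Literature.NumberTheory.EllipticCurves.ModularForms

namespace Summit.ABC.ABC.Cruxes.SteinbergCore.StubIdeasK1G41

/-- **HJ1 (generic curve).** `ξ(W; N⁺, N⁻) ≠ 0` ⟹ the `a_p(W)`-packet off `N⁺N⁻` is the packet of a
newform of some level `M ∣ N⁺N⁻`.  Route: `exists_generator_of_brandtXi_ne_zero` (eigen-line `ℤφ`),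
`XiSetup.sum_eq_zero_of_eigenLattice_lFunction_eq_span` (deg φ = 0), `thetaLift h1_holds S i φ` with
`cuspCoeff_thetaLift … 1` (`a₁ = 2 w_i φ_i ≠ 0` for `i` with `φ_i ≠ 0`, so the lift is `≠ 0`),
`heckeT_thetaLift` + eigen-line (`T_p Θ_i φ = a_p Θ_i φ`, `p ∤ N⁺N⁻`), then
`exists_isNewform0_of_eigenpacket`. [S/M glue, all links proved] -/
theorem hj1_exists_isNewform0_packet_of_brandtXi_ne_zero (Nplus Nminus : ℕ) [NeZero (Nplus * Nminus)]
    (W : WeierstrassCurve ℚ) [W.IsElliptic]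
    (h : brandtXi Nplus Nminus (fun n => W.LFunction n) ≠ 0) :
    ∃ (M : ℕ) (_ : NeZero M) (_ : M ∣ Nplus * Nminus) (g₀ : CuspForm (Gamma0 M) 2),
      IsNewform0 g₀ ∧ ∀ p : ℕ, p.Prime → ¬ p ∣ Nplus * Nminus → cuspCoeff g₀ p = (W.LFunction p : ℂ) := by
  sorry

/-- **HJ1 (Frey instance, the stub's binders).** -/
theorem hj1_frey (a b : ℤ) (hab : IsCoprime a b) (h0 : a * b * (a + b) ≠ 0) (N : ℕ) [NeZero N]
    (hN : (freyCurve a b).conductorNorm ℤ = N) (Nm : ℕ) (hNm : Nm ∣ N)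
    (hξ : brandtXi (N / Nm) Nm (fun n => (freyCurve a b).LFunction n) ≠ 0) :
    ∃ (M : ℕ) (_ : NeZero M) (_ : M ∣ N) (g₀ : CuspForm (Gamma0 M) 2),
      IsNewform0 g₀ ∧ ∀ p : ℕ, p.Prime → ¬ p ∣ N → cuspCoeff g₀ p = ((freyCurve a b).LFunction p : ℂ) := by
  sorry

/-- **HJ2 (fact-dependent completion; NOT claimed).**  From an off-`N` newform packet to THE newform
of `W` at level `N = N_W` (`IsNewformOf`: `a_n(f) = a_n(W)` for all `n`).  In the tree only as
(α) `isNewformOf_of_cuspCoeff_prime_eq (h₁ : exists_isNewformOf)` (global modularity, BCDT Thm A — contains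
`FreyModularity`) or (β) Shimura's construction `exists_weierstrassCurve_of_rational_isNewform0` (named, no
`_holds`) + rationality `coeffField g₀ = ⊥` + Faltings (`isIsogenous_iff_frobeniusTrace_eq_holds`, proved) +
`LFunction_eq_of_isIsogenous_holds` (proved) + Carayol's level/bad-prime part (named facts
`galoisRep_GL2_totallyReal_localGlobal`, `Carayol1986_finrank_inertiaInvariants`, Galois-side only). -/
def HJ2 : Prop :=
  ∀ (N : ℕ) [NeZero N] (W : WeierstrassCurve ℚ) [W.IsElliptic], W.conductorNorm ℤ = N →
    (∃ (M : ℕ) (_ : NeZero M) (_ : M ∣ N) (g₀ : CuspForm (Gamma0 M) 2),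
      IsNewform0 g₀ ∧ ∀ p : ℕ, p.Prime → ¬ p ∣ N → cuspCoeff g₀ p = (W.LFunction p : ℂ)) →
    ∃ f : CuspForm (Gamma0 N) 2, IsNewformOf W f

/-- Interface test: HJ1 ∘ HJ2 ∘ (tree, PROVED) `nonempty_modularParametrizationData_of_isNewformOf` gives the
datum input of the certificate `hMod`-free but `HJ2`-dependent — the exact trade Plan J makes. -/
theorem nonempty_datum_of_brandtXi_ne_zero (hJ2 : HJ2) (a b : ℤ) (hab : IsCoprime a b)
    (h0 : a * b * (a + b) ≠ 0) (N : ℕ) [NeZero N] (hN : (freyCurve a b).conductorNorm ℤ = N)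
    (Nm : ℕ) (hNm : Nm ∣ N) (hξ : brandtXi (N / Nm) Nm (fun n => (freyCurve a b).LFunction n) ≠ 0) :
    Nonempty (ModularParametrizationData (freyCurve a b) N) := by
  haveI : (freyCurve a b).IsElliptic := isElliptic_freyCurve h0
  obtain ⟨f, hf⟩ := hJ2 N (freyCurve a b) hN (hj1_frey a b hab h0 N hN Nm hNm hξ)
  exact nonempty_modularParametrizationData_of_isNewformOf hf

end Summit.ABC.ABC.Cruxes.SteinbergCore.StubIdeasK1G41
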